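import Literature.AlgebraicGeometry.RelativeSpec.GeometricQuotientFreeBaseChange
import Literature.AlgebraicGeometry.RelativeSpec.FreeActionOfPoints
import Mathlib.CategoryTheory.Monoidal.Cartesian.Over
import Mathlib.CategoryTheory.Monoidal.Grp
import Mathlib.AlgebraicGeometry.Morphisms.Flat
import HarnessLib

/-!
# The group law descends along a free finite quotient
# (Mumford, *Abelian Varieties* §7 Thm. 4: the quotient `X/K` of a group scheme by a finite group of
# translations is a group scheme and `X → X/K` a homomorphism)

Let `S` be a scheme, `A` a group object of the cartesian-monoidal category `Over S` of `S`-schemes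
(Mathlib `GrpObj`; `η`, `μ`, `ι`), `π : A ⟶ Q` an `S`-morphism whose underlying map of schemes is an
AFFINE geometric quotient (`ActionOver.IsGeometricQuotient`, Mumford's (1), (2)) for an action
`ρ : ActionOver π.left K` of a finite group `K` which is FREE (no `k ≠ 1` fixes a geometric point) and
which acts through `S`-AUTOMORPHISMS `τ : K →* Aut A` (`(τ k).hom.left = ρ(k)`) compatible with the
group law modulo `π`:

  `(τ k ▷ A) ≫ μ ≫ π = μ ≫ π`,  `(A ◁ τ k) ≫ μ ≫ π = μ ≫ π`,  `τ k ≫ ι ≫ π = ι ≫ π`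

(for the TRANSLATIONS `x ↦ σ·x` by a finite subgroup of sections of a commutative group scheme these
are associativity, commutativity and `(σx)⁻¹ = σ⁻¹x⁻¹`). Then (`exists_grpObj_isMonHom_of_free`)
**`Q` carries a structure of group object of `Over S` for which `π` is a homomorphism** (Mathlib
`IsMonHom`), with the separatedness of the scheme `Q.left` as the only further hypothesis (the target
of the descended morphisms).

Proof. The whiskered maps `π ▷ B : A ⊗ B → Q ⊗ B` and `B ◁ π` are BASE CHANGES of `π.left`
(`isPullback_whiskerRight_left`, `isPullback_whiskerLeft_left`: pasting of the two
`Over.tensorObj_left = pullback` squares), hence (i) flat and surjective — `π.left` is (★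
`IsGeometricQuotient.flat_of_free`) — so EPIMORPHISMS of schemes (Mathlib `epi_of_flat_of_surjective`)
and of `Over S` (`Over.epi_of_epi_left`): `epi_whiskerRight_of_free`, `epi_whiskerLeft_of_free`; and
(ii) again free affine geometric quotients for the whiskered action (★
`isGeometricQuotient_baseChange_of_free`; the action on the fibre product is assembled INSIDE the proof
from `τ` and Mathlib `whiskerRightIso` / `whiskerLeftIso` — no definition is introduced). The law
`μ ≫ π : A ⊗ A → Q` is `K`-invariant for the action on the first factor, so it descends along
`π ▷ A` to `Q ⊗ A → Q` (★ `IsGeometricQuotient.desc`); that descent is invariant for the action on the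
second factor (checked after the epimorphism `π ▷ A`, by `whisker_exchange`), so it descends along
`Q ◁ π` to `μ_Q : Q ⊗ Q → Q` with `(π ⊗ₘ π) ≫ μ_Q = μ ≫ π`; `ι ≫ π` descends along `π` to `ι_Q`;
`η_Q := η ≫ π`. Every group axiom for `(η_Q, μ_Q, ι_Q)` is the image of the corresponding axiom of `A`
under the epimorphisms `π`, `π ⊗ₘ π`, `(π ⊗ₘ π) ⊗ₘ π` (`cancel_epi`). Everything is proved; no named
facts, no definitions.

Consumers: ★/HOME `AbelianSchemes/AbelianSchemeConstSubgroupQuotient` (quotient of an abelian scheme by a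
finite constant subgroup of sections, HECKE-LINK file (i), cell hodgecm-mathlib), with
`τ := translationAut ∘ K.subtype`.

Mathlib searched (pin): `GrpObj`, `IsMonHom`, `CartesianMonoidalCategory (Over X)`
(`Over.tensorObj_left`, `Over.whiskerRight_left_fst/snd`, `Over.whiskerLeft_left_fst/snd`,
`Over.tensorHom_left`), `whisker_exchange`, `tensorHom_def`, `leftUnitor_naturality`,
`rightUnitor_naturality`, `associator_naturality`, `CartesianMonoidalCategory.comp_lift`/`lift_map`,
`epi_of_flat_of_surjective`, `Over.epi_of_epi_left`, `MorphismProperty.of_isPullback` (all used); Mathlib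
has group objects and flat epimorphisms but no quotients of group schemes.

## References

* D. Mumford, *Abelian Varieties* (1970), §7 Thm. 4 (p. 72) (quotient of a group scheme / abelian
  variety by a finite subgroup), §7 Thm. p. 66. [MumfordAV1970]
* D. Mumford, J. Fogarty, F. Kirwan, *Geometric Invariant Theory*, 3rd ed. (1994), Ch. 7 §1,
  Prop. 7.1 (p. 127). [MumfordFogartyKirwan1994]
* A. Grothendieck, *SGA 1*, Exp. V §1, Prop. 2.6, Déf. 2.7. [SGA1]
-/

noncomputable section

universe u

open CategoryTheory Limits AlgebraicGeometry MonoidalCategory CartesianMonoidalCategory MonObj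

namespace Literature.AlgebraicGeometry.RelativeSpec.ActionOver.IsGeometricQuotient

set_option backward.isDefEq.respectTransparency false

/-! ### Whiskering in `Over S` is base change -/

section Whisker

variable {S : Scheme.{u}} {A Q : Over S} (π : A ⟶ Q) (B : Over S)

/-- **`π ▷ B : A ⊗ B → Q ⊗ B` is the base change of `π.left` along `pr₁ : Q ⊗ B → Q`** (the tensor
product of `Over S` is the fibre product over `S`; pasting of the two pullback squares over `S`).
[cite: SGA1, Exp. V §1] -/
theorem isPullback_whiskerRight_left :
    IsPullback (pullback.fst A.hom B.hom) (π ▷ B).left π.left (pullback.fst Q.hom B.hom) := by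
  refine (IsPullback.of_right ?_ (Over.whiskerRight_left_fst π) (IsPullback.of_hasPullback Q.hom B.hom).flip).flip
  rw [Over.whiskerRight_left_snd, Over.w]
  exact (IsPullback.of_hasPullback A.hom B.hom).flip

/-- **`B ◁ π : B ⊗ A → B ⊗ Q` is the base change of `π.left` along `pr₂ : B ⊗ Q → Q`**.
[cite: SGA1, Exp. V §1] -/
theorem isPullback_whiskerLeft_left :
    IsPullback (pullback.snd B.hom A.hom) (B ◁ π).left π.left (pullback.snd B.hom Q.hom) := by
  refine (IsPullback.of_right ?_ (Over.whiskerLeft_left_snd π) (IsPullback.of_hasPullback B.hom Q.hom)).flip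
  rw [Over.whiskerLeft_left_fst, Over.w]
  exact IsPullback.of_hasPullback B.hom A.hom

/-- If `π.left` is flat and surjective, so is `(π ▷ B).left`, hence `π ▷ B` is an EPIMORPHISM of
`Over S` (Mathlib `epi_of_flat_of_surjective`, Stacks 02VW). [cite: SGA1, Exp. V §1] -/
theorem epi_whiskerRight [Flat π.left] [Surjective π.left] : Epi (π ▷ B) := by
  haveI : Flat (π ▷ B).left :=
    MorphismProperty.of_isPullback (isPullback_whiskerRight_left π B) ‹Flat π.left›
  haveI : Surjective (π ▷ B).left :=
    MorphismProperty.of_isPullback (isPullback_whiskerRight_left π B) ‹Surjective π.left›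
  haveI : Epi (π ▷ B).left := Flat.epi_of_flat_of_surjective _
  exact Over.epi_of_epi_left _

/-- If `π.left` is flat and surjective, `B ◁ π` is an epimorphism of `Over S`. [cite: SGA1, Exp. V §1] -/
theorem epi_whiskerLeft [Flat π.left] [Surjective π.left] : Epi (B ◁ π) := by
  haveI : Flat (B ◁ π).left :=
    MorphismProperty.of_isPullback (isPullback_whiskerLeft_left π B) ‹Flat π.left›
  haveI : Surjective (B ◁ π).left :=
    MorphismProperty.of_isPullback (isPullback_whiskerLeft_left π B) ‹Surjective π.left›
  haveI : Epi (B ◁ π).left := Flat.epi_of_flat_of_surjective _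
  exact Over.epi_of_epi_left _

/-- If `π.left` is flat and surjective, `π` is an epimorphism of `Over S`. [cite: SGA1, Exp. V §1] -/
theorem epi_of_flat_left [Flat π.left] [Surjective π.left] : Epi π :=
  haveI : Epi π.left := Flat.epi_of_flat_of_surjective _
  Over.epi_of_epi_left _

end Whisker

/-! ### Descent of the group law -/

variable {S : Scheme.{u}} {A Q : Over S} [GrpObj A] {π : A ⟶ Q} {K : Type u} [Group K] [Finite K]
  {ρ : ActionOver π.left K} (hq : ρ.IsGeometricQuotient π.left) [IsAffineHom π.left]
  (hpt : ∀ (Ω : Type u) [Field Ω] [IsAlgClosed Ω] (x : Spec (.of Ω) ⟶ A.left) (k : K), k ≠ 1 →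
    x ≫ (ρ.aut k).hom ≠ x)
  (τ : K →* Aut A) (hτ : ∀ k : K, (τ k).hom.left = (ρ.aut k).hom)
  (hμ₁ : ∀ k : K, ((τ k).hom ▷ A) ≫ μ ≫ π = μ ≫ π)
  (hμ₂ : ∀ k : K, (A ◁ (τ k).hom) ≫ μ ≫ π = μ ≫ π)
  (hι : ∀ k : K, (τ k).hom ≫ ι ≫ π = ι ≫ π)
  [Q.left.IsSeparated]

include hq hpt hτ hμ₁ hμ₂ hι

/-- **The group law descends along a free finite quotient** (Mumford AV §7 Thm. 4, in the relative
form of [MFK94] Prop. 7.1): under the hypotheses of this section — `π : A ⟶ Q` over `S` with `π.left`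
an affine geometric quotient for a FREE action of the finite group `K` (`[Finite K]`) acting through
`S`-automorphisms `τ` compatible with `μ`, `ι` modulo `π`, `Q.left` separated — there is a group
object structure on `Q` in `Over S` for which `π` is a homomorphism (`η_Q = η ≫ π`,
`(π ⊗ₘ π) ≫ μ_Q = μ ≫ π`, `π ≫ ι_Q = ι ≫ π`).
[cite: MumfordAV1970, §7 Thm. 4 (p. 72)] [cite: MumfordFogartyKirwan1994, Ch. 7 §1 Prop. 7.1 (p. 127)] -/
theorem exists_grpObj_isMonHom_of_free : ∃ _ : GrpObj Q, IsMonHom π := by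
  -- freeness in ring form; flat, surjective, epi
  haveI : Fintype K := Fintype.ofFinite K
  have hfree := ρ.free_of_forall_comp_aut_ne hpt
  haveI : Flat π.left := hq.flat_of_free hfree
  haveI : Surjective π.left := ⟨hq.surjective⟩
  haveI hepi : Epi π := epi_of_flat_left π
  have hτπ : ∀ k : K, (τ k).hom ≫ π = π := fun k =>
    Over.OverMorphism.ext (by rw [Over.comp_left, hτ]; exact hq.comp_eq k)
  -- (1) the action on `A ⊗ A` through the first factor, over `π ▷ A`
  let a₁ : K →* Aut (A ⊗ A).left :=
    { toFun := fun k => (Over.forget S).mapIso (whiskerRightIso (τ k) A)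
      map_one' := by
        ext; change ((τ 1).hom ▷ A).left = 𝟙 _
        rw [map_one]; change ((Iso.refl A).hom ▷ A).left = _
        rw [Iso.refl_hom, id_whiskerRight]; rfl
      map_mul' := fun j k => by
        ext; change ((τ (j * k)).hom ▷ A).left = ((τ k).hom ▷ A).left ≫ ((τ j).hom ▷ A).left
        rw [map_mul, Aut.Aut_mul_def, Iso.trans_hom, comp_whiskerRight, Over.comp_left] }
  have ha₁ : ∀ k, (a₁ k).hom = ((τ k).hom ▷ A).left := fun k => rfl
  let ρ₁ : ActionOver (π ▷ A).left K :=
    { aut := a₁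
      aut_comp := fun k => by
        rw [ha₁, ← Over.comp_left, ← comp_whiskerRight, hτπ] }
  have hρ₁ : ∀ k, (ρ₁.aut k).hom ≫ pullback.fst A.hom A.hom = pullback.fst A.hom A.hom ≫ (ρ.aut k).hom :=
    fun k => by change (a₁ k).hom ≫ _ = _; rw [ha₁, Over.whiskerRight_left_fst, hτ]
  have hq₁ : ρ₁.IsGeometricQuotient (π ▷ A).left :=
    hq.isGeometricQuotient_baseChange_of_free hfree (isPullback_whiskerRight_left π A) ρ₁ hρ₁
  -- descend `μ ≫ π` along `π ▷ A`
  have hinv₁ : ∀ k, (ρ₁.aut k).hom ≫ (μ ≫ π).left = (μ ≫ π).left := fun k => by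
    change (a₁ k).hom ≫ _ = _
    rw [ha₁, ← Over.comp_left, hμ₁]
  obtain ⟨m₁, hm₁⟩ : ∃ m₁ : (Q ⊗ A).left ⟶ Q.left, (π ▷ A).left ≫ m₁ = (μ ≫ π).left :=
    ⟨hq₁.desc _ hinv₁, hq₁.comp_desc _ hinv₁⟩
  -- (2) the action on `Q ⊗ A` through the second factor, over `Q ◁ π`
  let a₂ : K →* Aut (Q ⊗ A).left :=
    { toFun := fun k => (Over.forget S).mapIso (whiskerLeftIso Q (τ k))
      map_one' := by
        ext; change (Q ◁ (τ 1).hom).left = 𝟙 _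
        rw [map_one]; change (Q ◁ (Iso.refl A).hom).left = _
        rw [Iso.refl_hom, MonoidalCategory.whiskerLeft_id]; rfl
      map_mul' := fun j k => by
        ext; change (Q ◁ (τ (j * k)).hom).left = (Q ◁ (τ k).hom).left ≫ (Q ◁ (τ j).hom).left
        rw [map_mul, Aut.Aut_mul_def, Iso.trans_hom, MonoidalCategory.whiskerLeft_comp,
          Over.comp_left] }
  have ha₂ : ∀ k, (a₂ k).hom = (Q ◁ (τ k).hom).left := fun k => rfl
  let ρ₂ : ActionOver (Q ◁ π).left K :=
    { aut := a₂
      aut_comp := fun k => by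
        rw [ha₂, ← Over.comp_left, ← MonoidalCategory.whiskerLeft_comp, hτπ] }
  have hρ₂ : ∀ k, (ρ₂.aut k).hom ≫ pullback.snd Q.hom A.hom = pullback.snd Q.hom A.hom ≫ (ρ.aut k).hom :=
    fun k => by change (a₂ k).hom ≫ _ = _; rw [ha₂, Over.whiskerLeft_left_snd, hτ]
  have hq₂ : ρ₂.IsGeometricQuotient (Q ◁ π).left :=
    hq.isGeometricQuotient_baseChange_of_free hfree (isPullback_whiskerLeft_left π Q) ρ₂ hρ₂
  -- `m₁` is invariant for the second-factor action: check after the epimorphism `π ▷ A`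
  have hinv₂ : ∀ k, (ρ₂.aut k).hom ≫ m₁ = m₁ := fun k => by
    change (a₂ k).hom ≫ m₁ = m₁
    refine hq₁.desc_unique ?_
    rw [ha₂, ← Category.assoc, ← Over.comp_left, ← whisker_exchange, Over.comp_left, Category.assoc,
      hm₁, ← Over.comp_left, hμ₂]
  obtain ⟨m₂, hm₂⟩ : ∃ m₂ : (Q ⊗ Q).left ⟶ Q.left, (Q ◁ π).left ≫ m₂ = m₁ :=
    ⟨hq₂.desc _ hinv₂, hq₂.comp_desc _ hinv₂⟩
  -- the descended law as an `S`-morphism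
  haveI : Flat (π ▷ A).left :=
    MorphismProperty.of_isPullback (isPullback_whiskerRight_left π A) ‹Flat π.left›
  haveI : Surjective (π ▷ A).left :=
    MorphismProperty.of_isPullback (isPullback_whiskerRight_left π A) ‹Surjective π.left›
  haveI : Epi (π ▷ A).left := Flat.epi_of_flat_of_surjective _
  haveI : Flat (Q ◁ π).left :=
    MorphismProperty.of_isPullback (isPullback_whiskerLeft_left π Q) ‹Flat π.left›
  haveI : Surjective (Q ◁ π).left :=
    MorphismProperty.of_isPullback (isPullback_whiskerLeft_left π Q) ‹Surjective π.left›
  haveI : Epi (Q ◁ π).left := Flat.epi_of_flat_of_surjective _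
  haveI : Flat (π ⊗ₘ π).left := by rw [tensorHom_def, Over.comp_left]; infer_instance
  haveI : Surjective (π ⊗ₘ π).left := by rw [tensorHom_def, Over.comp_left]; infer_instance
  have hw₂ : m₂ ≫ Q.hom = (Q ⊗ Q).hom := by
    rw [← cancel_epi (Q ◁ π).left, ← cancel_epi (π ▷ A).left]
    calc (π ▷ A).left ≫ (Q ◁ π).left ≫ m₂ ≫ Q.hom = (μ ≫ π).left ≫ Q.hom := by
          rw [reassoc_of% hm₂, reassoc_of% hm₁]
      _ = (A ⊗ A).hom := Over.w _
      _ = ((π ▷ A) ≫ (Q ◁ π)).left ≫ (Q ⊗ Q).hom := (Over.w _).symm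
      _ = (π ▷ A).left ≫ (Q ◁ π).left ≫ (Q ⊗ Q).hom := by rw [Over.comp_left, Category.assoc]
  obtain ⟨mQ, hmQl⟩ : ∃ mQ : Q ⊗ Q ⟶ Q, mQ.left = m₂ := ⟨Over.homMk m₂ hw₂, rfl⟩
  have hmQ : (π ⊗ₘ π) ≫ mQ = μ ≫ π := by
    ext
    rw [tensorHom_def, Over.comp_left, Over.comp_left, hmQl, Category.assoc, hm₂, hm₁]
  -- the inverse
  have hinvι : ∀ k, (ρ.aut k).hom ≫ (ι ≫ π).left = (ι ≫ π).left := fun k => by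
    rw [← hτ, ← Over.comp_left, hι]
  obtain ⟨i, hi⟩ : ∃ i : Q.left ⟶ Q.left, π.left ≫ i = (ι ≫ π).left :=
    ⟨hq.desc _ hinvι, hq.comp_desc _ hinvι⟩
  haveI : Epi π.left := Flat.epi_of_flat_of_surjective _
  have hwi : i ≫ Q.hom = Q.hom := by
    rw [← cancel_epi π.left, reassoc_of% hi, Over.w, Over.w]
  obtain ⟨iQ, hiQl⟩ : ∃ iQ : Q ⟶ Q, iQ.left = i := ⟨Over.homMk i hwi, rfl⟩
  have hiQ : π ≫ iQ = ι ≫ π := by ext; rw [Over.comp_left, hiQl, hi]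
  -- epimorphisms used to transfer the axioms
  haveI : Epi (π ⊗ₘ π) := by
    rw [tensorHom_def]; haveI := epi_whiskerRight π A; haveI := epi_whiskerLeft π Q
    exact epi_comp _ _
  haveI : Epi ((π ⊗ₘ π) ⊗ₘ π) := by
    rw [tensorHom_def]; haveI := epi_whiskerRight (π ⊗ₘ π) A; haveI := epi_whiskerLeft π (Q ⊗ Q)
    exact epi_comp _ _
  haveI := epi_whiskerLeft π (𝟙_ (Over S))
  haveI := epi_whiskerRight π (𝟙_ (Over S))
  -- the axioms, transferred along the epimorphisms
  have h_one_mul : ((η ≫ π) ▷ Q) ≫ mQ = (λ_ Q).hom := by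
    rw [← cancel_epi (𝟙_ (Over S) ◁ π), whisker_exchange_assoc, comp_whiskerRight, Category.assoc,
      ← tensorHom_def_assoc π π mQ, hmQ, MonObj.one_mul_assoc, leftUnitor_naturality]
  have h_mul_one : (Q ◁ (η ≫ π)) ≫ mQ = (ρ_ Q).hom := by
    rw [← cancel_epi (π ▷ 𝟙_ (Over S)), ← whisker_exchange_assoc, MonoidalCategory.whiskerLeft_comp,
      Category.assoc, ← tensorHom_def'_assoc π π mQ, hmQ, MonObj.mul_one_assoc, rightUnitor_naturality]
  have hππ : ((π ⊗ₘ π) ⊗ₘ π) ≫ (mQ ▷ Q) = (μ ▷ A) ≫ (π ⊗ₘ π) := by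
    rw [tensorHom_def (π ⊗ₘ π) π, Category.assoc, whisker_exchange mQ π, ← comp_whiskerRight_assoc,
      hmQ, comp_whiskerRight, Category.assoc, ← tensorHom_def π π]
  have hππ' : (π ⊗ₘ (π ⊗ₘ π)) ≫ (Q ◁ mQ) = (A ◁ μ) ≫ (π ⊗ₘ π) := by
    rw [tensorHom_def π (π ⊗ₘ π), Category.assoc, ← MonoidalCategory.whiskerLeft_comp, hmQ,
      MonoidalCategory.whiskerLeft_comp, ← whisker_exchange_assoc π μ, ← tensorHom_def π π]
  have h_mul_assoc : (mQ ▷ Q) ≫ mQ = (α_ Q Q Q).hom ≫ (Q ◁ mQ) ≫ mQ := by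
    rw [← cancel_epi ((π ⊗ₘ π) ⊗ₘ π), reassoc_of% hππ, hmQ, associator_naturality_assoc,
      reassoc_of% hππ', hmQ, MonObj.mul_assoc_assoc]
  have h_left_inv : lift iQ (𝟙 Q) ≫ mQ = toUnit Q ≫ η ≫ π := by
    rw [← cancel_epi π, comp_lift_assoc, hiQ, Category.comp_id, comp_toUnit_assoc,
      show lift (ι ≫ π) π = lift ι (𝟙 A) ≫ (π ⊗ₘ π) by rw [lift_map, Category.id_comp],
      Category.assoc, hmQ, GrpObj.left_inv_assoc]
  have h_right_inv : lift (𝟙 Q) iQ ≫ mQ = toUnit Q ≫ η ≫ π := by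
    rw [← cancel_epi π, comp_lift_assoc, hiQ, Category.comp_id, comp_toUnit_assoc,
      show lift π (ι ≫ π) = lift (𝟙 A) ι ≫ (π ⊗ₘ π) by rw [lift_map, Category.id_comp],
      Category.assoc, hmQ, GrpObj.right_inv_assoc]
  -- the group object
  letI mon : MonObj Q :=
    { one := η ≫ π
      mul := mQ
      one_mul := h_one_mul
      mul_one := h_mul_one
      mul_assoc := h_mul_assoc }
  exact ⟨{ inv := iQ, left_inv := h_left_inv, right_inv := h_right_inv },
    { one_hom := rfl, mul_hom := hmQ.symm }⟩

end Literature.AlgebraicGeometry.RelativeSpec.ActionOver.IsGeometricQuotient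

end
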